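import Summits.ValiantsHypothesis.ValiantsHypothesis.Theorems.KPlusLogSqLawTropicalBPotentialClouds
import Summits.ValiantsHypothesis.ValiantsHypothesis.Theorems.KPlusLogSqLawTropicalBSignsFree

/-!
# Route «KPlusLogSqLaw», crux `TropicalB` (stmt-ValiantsHypothesis-19771) — THE POTENTIAL-CLOUD NORMAL FORM, crux form:
# `TropicalB` as a bound for term sequences carrying `2m` potential sequences (no design, no valuations)

HONEST FRAMING.  Helper file (cell `pub-symmetroid`, seat val-sym-trop-p1 g27, 2026-08-29; `--supports stmt-ValiantsHypothesis-19771 --as helper`) toward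
the registered stubs `stub_tropThin` / `stub_tropFat` of `Cruxes/TropicalB/Lines/birth.lean`.  The one file of the pair (`…TropicalBPotentialClouds`,
this) that imports the route: it composes the route-independent normal form `PotentialClouds.tropRowD_iff_potentialClouds` with `tropicalB_iff_unsigned`
(…TropicalBSignsFree, signs are worth a factor two).  An equivalence; it bounds nothing: `TropicalB`, both stubs and the residual of record (long carries)
stay OPEN; nothing here bears on `WeakLifting`, DoorA26 / DoorA34, `MatrixDescartes` (stmt-ValiantsHypothesis-18050) or VP ≠ VNP.  It is the PRIMAL twin of
`MasterLaw.tropicalB_iff_certificateFree` (val-sym-trop-p1 g26, p696432): there the design is eliminated by Farkas multipliers (what a REFUTATION of a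
sequence looks like), here by per-step potentials (what a CONSTRUCTION of a sequence looks like).

THE STATEMENT (`tropicalB_iff_potentialClouds`).  `TropicalB` holds iff there is an absolute `C` such that for all `m, K`, every exponent vector
`d : Fin K → ℕ` and every term sequence `p 0, …, p n` of format `(m, K)` with consecutive terms distinct which carries a POTENTIAL CLOUD — strictly
increasing integer slopes `θ k` and rational row / column potentials `u k, w k : Fin m → ℚ` (`k ≤ n`) such that for every `k ≤ n` and every column `b`
the gauged score `u j ((p k).1 b) + w j b − θ j · d ((p k).2 b)` of the incidence of `p k` in column `b` is, as a function of the step `j ≤ n`,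
minimal at `j = k`, strictly smaller than at every step `j` at which `p j` does not carry that incidence — satisfies `n ≤ 2^(C (K + ⌊log₂ m⌋²))`.
[this cell; LP duality is folklore]
-/

set_option linter.dupNamespace false
set_option autoImplicit false

namespace Summit.ValiantsHypothesis.ValiantsHypothesis.Theorems.KPlusLogSqLaw.PotentialClouds

open Summit.ValiantsHypothesis.ValiantsHypothesis.Theorems.MatrixDescartes.Negative
open scoped BigOperators

/-- **`TropicalB` AS A BOUND FOR SEQUENCES WITH POTENTIAL CLOUDS (kernel iff).**  The crux is equivalent to: there is an absolute `C` such that every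
term sequence of format `(m, K)` with consecutive terms distinct that carries strictly increasing integer slopes and rational per-step row / column
potentials whose gauged scores of each chain incidence are minimised exactly on its usage set has `n ≤ 2^(C (K + ⌊log₂ m⌋²))`.  Composition of
`tropicalB_iff_unsigned` (…TropicalBSignsFree, `C ↦ C + 1` inside) with `tropRowD_iff_potentialClouds`.  Nothing is bounded; `TropicalB` stays OPEN.
[this cell] -/
theorem tropicalB_iff_potentialClouds :
    Summit.ValiantsHypothesis.ValiantsHypothesis.Theses.KPlusLogSqLaw.TropicalB ↔
    ∃ C : ℕ, ∀ (m K : ℕ) (d : Fin K → ℕ) (n : ℕ) (p : ℕ → Equiv.Perm (Fin m) × (Fin m → Fin K)),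
      (∀ k < n, p k ≠ p (k + 1)) →
      (∃ (θ : ℕ → ℤ) (u w : ℕ → Fin m → ℚ), (∀ k < n, θ k < θ (k + 1)) ∧
        ∀ k ≤ n, ∀ k' ≤ n, ∀ b : Fin m,
          (u k ((p k).1 b) + w k b - (θ k : ℚ) * (d ((p k).2 b) : ℚ) ≤
              u k' ((p k).1 b) + w k' b - (θ k' : ℚ) * (d ((p k).2 b) : ℚ)) ∧
          (¬ ((p k').1 b = (p k).1 b ∧ (p k').2 b = (p k).2 b) →
            u k ((p k).1 b) + w k b - (θ k : ℚ) * (d ((p k).2 b) : ℚ) <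
              u k' ((p k).1 b) + w k' b - (θ k' : ℚ) * (d ((p k).2 b) : ℚ))) →
      n ≤ 2 ^ (C * (K + Nat.log 2 m ^ 2)) := by
  rw [tropicalB_iff_unsigned]
  refine exists_congr fun C => forall_congr' fun m => ?_
  constructor
  · intro h K
    exact (tropRowD_iff_potentialClouds m K _).mp (h K)
  · intro h K
    exact (tropRowD_iff_potentialClouds m K _).mpr (h K)

end Summit.ValiantsHypothesis.ValiantsHypothesis.Theorems.KPlusLogSqLaw.PotentialClouds
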